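/-
Copyright (c) 2026 the pub-hodgecm-mathlib formalisation cell (harness21).  Prover seat hodgecm-mathlib-LH4-p19 (g2), req620 Track A «(D-RAM) FOUR-FRAME» squad
(STAGE-1b, row (2) of the piece `f_{T₊}`, the (β₂) road (R-36) «PURE-CELL LEDGER»; β₂ sub-dealer LH4-p04 lineage, lane B (RamK), row (L-D♭) «the diagonal cell below the
clean line» — the COUNT, K♮-side digits), 2026-09-04.
-/
import Summits.HodgeConjecture.HodgeConjecture.Theorems.F0P3cDyRamDiagonalCellLabelDigits      -- ★ (this seat, K1): `sum_normSign_eq_card_sub_card`; brings ★ `normSign_eq_of_near`, `normSign_mul_of_fixed`, `exists_fixed_unit_not_norm_v_sub_one_le`, `v_varpi_pow`, `normSign_eq_one_or`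
import HarnessLib

/-!
# Crux `H413`, line LH4 «(D-RAM) FOUR-FRAME» — STAGE-1b, row (2), the (β₂) road (R-36), lane B, row (L-D♭), THE COUNT — K♮-SIDE DIGITS: «THE LITERAL HALVES EVERY
# TAIL-DIGIT ORBIT» — in the one-field RamK line `(M; ρ, Θ)` the `M∕K♮`-norm class of `ŵ(V)∕c`, `ŵ(V) = (V − ρθ₀)∕(θ₀ − ρθ₀)`, takes each value on exactly HALF of the
# `F`-digits `V ≡ V₀ (𝔭_F^{d−g})` modulo `𝔭_F^d`, for every `1 ≤ g` (conductor of `M∕K♮` is `d`; `𝒪_Fˣ ⊆ N(M^×)`)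

Cell `hodgecm-mathlib` (D-0151), FLOOR 0, crux item H413 = `stmt-HodgeConjecture-24833`, route of record `HCCMUnconditional`; squad F0∕P3c∕LH4; lane
`--supports stmt-HodgeConjecture-24833 --as helper` (count-neutral; pays NO tier-0 row).  THEOREMS ONLY (no `def`, no instance, no notation, no `sorry`, default heartbeats);
★-only imports; states NO law; (β₂) stays a HYPOTHESIS.  DATUM-FREE one-field letters: `K` (= the line model `M`) with two commuting isometric involutions `ρ` (fixing `E`) and `Θ`
(fixing `K♮`; the RAMIFIED datum `IsRamifiedQuadraticDatum Θ ϖE d t` — type RamK), the «doubly fixed units are `Θ`-norms» letter `hFN` (★ `forall_fixed_fixed_exists_mul_theta_eq_of_frame`),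
and a `Θ`-fixed integer `θ₀` moved by `ρ` by a unit (`|θ₀ − ρθ₀| = 1`: `𝒪_{K♮} = 𝒪_F ⊕ 𝒪_F·ρθ₀`).  «`F`-digits» = `ρ`- AND `Θ`-fixed integers; `𝔭_F^n` reads `|·| ≤ |ϖE|^{2n}`.

WHY (memo `F0/P3c/LH4/LH4-p19/g0/MECH-LDflat.v1.LH4p19g0.md` 8f57960d §2–§3; sibling ★-cand `F0P3cDyRamDiagonalCellLabelDigits` = the E-side count with the literal ABSTRACT).
In the (T, V)-coordinates of the diagonal cell (`ŵ = T·ŵ(V)`, `T = Tr_ρ ŵ ∈ 𝒪_Fˣ`, `ŵ(V)` the unit of trace `1` with second coordinate `V`), the LITERAL of a D-vertex is the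
`N_{M∕K♮}`-class of `ŵ∕c` for a fixed `Θ`-fixed unit `c` (the class of the form scalar); since `𝒪_Fˣ ⊆ N(M^×)` (`hFN`) it is a predicate of `V` alone,
`LIT_c(V) :⟺ ŵ(V)∕c ∈ N_Θ(M^×)`.  THIS FILE proves the HALVING letter the E-side count consumes: on every tail-digit orbit `{V ≡ V₀ (𝔭_F^{d−g})}` (digits modulo `𝔭_F^d`),
`LIT_c` holds on exactly half the digits (`1 ≤ g`).  Mechanism (Serre V §3 Cor. 3 for the datum `(Θ, ϖE, d)`: a `Θ`-fixed NON-norm `c₁ ≡ 1 (mod ϖE^{2(d−1)})`, ★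
`exists_fixed_unit_not_norm_v_sub_one_le`): `c₁·ŵ(V) = f″·ŵ(V′)` with `f″ ∈ 𝒪_Fˣ` (a norm by `hFN`) and `V′ ≡ V (𝔭_F^{d−1}) ⊆ (𝔭_F^{d−g})` — the coordinates of `c₁(V − ρθ₀)`
in the basis `{1, ρθ₀}` — so `V ↦ digit(V′)` is a sign-reversing permutation of the orbit's digits.
* §1 `map_coordq`∕`map_coordp` (coordinates `x = p + q·ρθ₀`, `p, q` doubly fixed), `hatw_add_map_hatw` (`Tr_ρ ŵ(V) = 1`), `mul_hatw_eq` (`a·ŵ(V) = (−q)·ŵ(−p∕q)`),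
  `v_coordq_add_one_le` ∕ `v_transportV_sub_le` (`|q + 1| ≤ |a − 1|`, `|V′ − V| ≤ |a − 1|`), `v_sub_le_of_hatw_div` (digits are recovered from `ŵ(V)∕f` modulo `𝔭^n`).
* §2 HEAD `sum_normSign_hatw_div_eq_zero` ∕ `two_mul_card_filter_lit_eq_card` — for a digit system `F` of the orbit `{V ≡ V₀ (𝔭_F^{d−g})}` modulo `𝔭_F^d` and any `Θ`-fixed unit `c`:
  `Σ_{V ∈ F} ω_Θ(ŵ(V)∕c) = 0`, i.e. `2·#{V ∈ F ∣ ω_Θ(ŵ(V)∕c) = 1} = #F` — the `hhalf` letter of ★-cand `card_filter_lit_plus_eq_card_filter_lit_not` (after transport `jE`).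
WHAT IS NOT CLAIMED: the (T, V)-decomposition of the cell and the lattice fibration (K3–K5), the E-side count (sibling), anything about labels.
HONEST LABEL.  Count-neutral local algebra; nothing printed is asserted; no census law is stated; `HC_CM` is proved only modulo the 7 printed citations (2 remaining named inputs:
hLiu418 = `stmt-HodgeConjecture-24832`, h413 = `stmt-HodgeConjecture-24833`) until rung 0 closes.
## References
* [Serre1979] J.-P. Serre, *Local Fields*, GTM 67 (1979): Ch. V §3 Prop. 5, Cor. 3 pp. 85–87 (conductor of a ramified quadratic extension), Ch. V §2 Prop. 3 (units are norms in the
  unramified case), Ch. XV §2.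
* [Flicker1998UnitaryFL] Y. Z. Flicker, *Elementary proof of the fundamental lemma for a unitary group*, Canad. J. Math. 50 (1998): Prop. 7 p. 84 (torus-orbit census, type RamK).
* [Kottwitz1986BaseChangeUnits] R. E. Kottwitz, *Base change for unit elements of Hecke algebras*, Compositio Math. 60 (1986): §1 pp. 240–241.
* [Rogawski1990] J. D. Rogawski, *Automorphic Representations of Unitary Groups in Three Variables*, Ann. of Math. Stud. 123 (1990): §4.9 Prop. 4.9.1 (b) p. 55, §12.2.
-/

set_option autoImplicit false

noncomputable section

namespace Summit.HodgeConjecture.HodgeConjecture.Cruxes.H413.F0P3cDyRamDiagonalCellLiteralDigits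

open scoped Valued WithZero
open WithZero Finset
open Literature.NumberTheory.Automorphic.UnitaryThreeFourFrame (IsRamifiedQuadraticDatum normSign normSign_of_isNorm normSign_of_not_isNorm)
open Literature.NumberTheory.LocalFields.WildQuadraticDatum (v_varpi_pow normSign_eq_of_near normSign_mul_of_fixed exists_fixed_unit_not_norm_v_sub_one_le)
open Summit.HodgeConjecture.HodgeConjecture.Cruxes.H413.F0P3cDyRamNormPairsIffFrames (normSign_eq_one_or)
open Summit.HodgeConjecture.HodgeConjecture.Cruxes.H413.F0P3cDyRamDiagonalCellLabelDigits (sum_normSign_eq_card_sub_card)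

variable {K : Type} [Field K] [Valued K ℤᵐ⁰] {ρ Θ : K →+* K} {θ₀ : K}

/-! ## §1 Coordinates in the basis `{1, ρθ₀}`, the unit `ŵ(V)` of trace one, and the transport `a·ŵ(V) = f″·ŵ(V′)` -/

omit [Valued K ℤᵐ⁰] in
/-- **THE `ρθ₀`-COORDINATE IS DOUBLY FIXED**: `q = (x − ρx)∕(ρθ₀ − θ₀)` has `ρq = q` and, for `Θx = x`, `Θq = q` (`ρ`, `Θ` commuting, `ρρ = 1`, `Θθ₀ = θ₀`, `ρθ₀ ≠ θ₀`).
[cite: Serre1979, Ch. V §2 Prop. 3] -/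
theorem map_coordq (hρρ : ∀ x, ρ (ρ x) = x) (hΘρ : ∀ x, Θ (ρ x) = ρ (Θ x)) (hΘθ₀ : Θ θ₀ = θ₀) (hθ₀ : ρ θ₀ ≠ θ₀) {x : K} (hΘx : Θ x = x) :
    ρ ((x - ρ x) / (ρ θ₀ - θ₀)) = (x - ρ x) / (ρ θ₀ - θ₀) ∧ Θ ((x - ρ x) / (ρ θ₀ - θ₀)) = (x - ρ x) / (ρ θ₀ - θ₀) := by
  have hδ : ρ θ₀ - θ₀ ≠ 0 := sub_ne_zero.2 hθ₀
  have hδ' : θ₀ - ρ θ₀ ≠ 0 := sub_ne_zero.2 (Ne.symm hθ₀)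
  refine ⟨?_, by rw [map_div₀, map_sub, map_sub, hΘρ, hΘx, hΘρ, hΘθ₀]⟩
  rw [map_div₀, map_sub, map_sub, hρρ, hρρ, div_eq_div_iff hδ' hδ]
  ring

omit [Valued K ℤᵐ⁰] in
/-- **THE `1`-COORDINATE IS DOUBLY FIXED**: `p = x − q·ρθ₀` has `ρp = p` (by the definition of `q`) and `Θp = p`; and `x = p + q·ρθ₀`. [cite: Serre1979, Ch. V §2 Prop. 3] -/
theorem map_coordp (hρρ : ∀ x, ρ (ρ x) = x) (hΘρ : ∀ x, Θ (ρ x) = ρ (Θ x)) (hΘθ₀ : Θ θ₀ = θ₀) (hθ₀ : ρ θ₀ ≠ θ₀) {x : K} (hΘx : Θ x = x) :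
    ρ (x - (x - ρ x) / (ρ θ₀ - θ₀) * ρ θ₀) = x - (x - ρ x) / (ρ θ₀ - θ₀) * ρ θ₀ ∧
      Θ (x - (x - ρ x) / (ρ θ₀ - θ₀) * ρ θ₀) = x - (x - ρ x) / (ρ θ₀ - θ₀) * ρ θ₀ := by
  have hδ : ρ θ₀ - θ₀ ≠ 0 := sub_ne_zero.2 hθ₀
  obtain ⟨hρq, hΘq⟩ := map_coordq hρρ hΘρ hΘθ₀ hθ₀ hΘx
  refine ⟨?_, by rw [map_sub, map_mul, hΘq, hΘx, hΘρ, hΘθ₀]⟩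
  rw [map_sub, map_mul, hρq, hρρ]
  have key : (x - ρ x) / (ρ θ₀ - θ₀) * (ρ θ₀ - θ₀) = x - ρ x := div_mul_cancel₀ _ hδ
  linear_combination key

omit [Valued K ℤᵐ⁰] in
/-- **`Tr_ρ ŵ(V) = 1`**: for `ρ`-fixed `V` and `ρθ₀ ≠ θ₀`, `ŵ(V) = (V − ρθ₀)∕(θ₀ − ρθ₀)` satisfies `ŵ(V) + ρ ŵ(V) = 1`. [cite: Serre1979, Ch. V §2 Prop. 3] -/
theorem hatw_add_map_hatw (hρρ : ∀ x, ρ (ρ x) = x) (hθ₀ : ρ θ₀ ≠ θ₀) {V : K} (hρV : ρ V = V) :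
    (V - ρ θ₀) / (θ₀ - ρ θ₀) + ρ ((V - ρ θ₀) / (θ₀ - ρ θ₀)) = 1 := by
  have hδ' : θ₀ - ρ θ₀ ≠ 0 := sub_ne_zero.2 (Ne.symm hθ₀)
  rw [map_div₀, map_sub, map_sub, hρρ, hρV]
  have e : ρ θ₀ - θ₀ = -(θ₀ - ρ θ₀) := by ring
  rw [e, div_neg, ← sub_eq_add_neg, ← sub_div, div_eq_one_iff_eq hδ']
  ring

omit [Valued K ℤᵐ⁰] in
/-- **THE TRANSPORT IDENTITY `a·ŵ(V) = (−q)·ŵ(−p∕q)`** for `x = a(V − ρθ₀) = p + q·ρθ₀`, `q ≠ 0`. [cite: Serre1979, Ch. V §2 Prop. 3] -/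
theorem mul_hatw_eq (hθ₀ : ρ θ₀ ≠ θ₀) {a V p q : K} (hq : q ≠ 0) (hx : a * (V - ρ θ₀) = p + q * ρ θ₀) :
    a * ((V - ρ θ₀) / (θ₀ - ρ θ₀)) = (-q) * ((-p / q - ρ θ₀) / (θ₀ - ρ θ₀)) := by
  have hδ' : θ₀ - ρ θ₀ ≠ 0 := sub_ne_zero.2 (Ne.symm hθ₀)
  rw [mul_div_assoc', hx]
  field_simp
  ring

/-- **THE TRANSPORT MOVES THE DIGIT BY AT MOST `|a − 1|`.**  `ρ` an isometric involution, `|θ₀ − ρθ₀| = 1`, `|θ₀| ≤ 1`, `ρV = V`, `|V| ≤ 1`, `|a − 1| < 1`: the coordinates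
`(p, q)` of `x = a(V − ρθ₀)` satisfy `|q + 1| ≤ |a − 1|`, `|q| = 1`, and `|−p∕q − V| ≤ |a − 1|` (`q + 1 = ((a − 1)(V − ρθ₀) − ρ(a − 1)(V − θ₀))∕(ρθ₀ − θ₀)`,
`−p∕q − V = −(a + q)(V − ρθ₀)∕q`). [cite: Serre1979, Ch. V §3 Cor. 3 pp. 85–87] -/
theorem v_transport_le (hρρ : ∀ x, ρ (ρ x) = x) (hvρ : ∀ x, Valued.v (ρ x) = Valued.v x) (hθρ : Valued.v (θ₀ - ρ θ₀) = 1) (hθ1 : Valued.v θ₀ ≤ 1)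
    {a V : K} (ha : Valued.v (a - 1) < 1) (hρV : ρ V = V) (hV1 : Valued.v V ≤ 1) :
    Valued.v ((a * (V - ρ θ₀) - ρ (a * (V - ρ θ₀))) / (ρ θ₀ - θ₀) + 1) ≤ Valued.v (a - 1) ∧
      Valued.v ((a * (V - ρ θ₀) - ρ (a * (V - ρ θ₀))) / (ρ θ₀ - θ₀)) = 1 ∧
      Valued.v (-(a * (V - ρ θ₀) - (a * (V - ρ θ₀) - ρ (a * (V - ρ θ₀))) / (ρ θ₀ - θ₀) * ρ θ₀) /
          ((a * (V - ρ θ₀) - ρ (a * (V - ρ θ₀))) / (ρ θ₀ - θ₀)) - V) ≤ Valued.v (a - 1) := by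
  have hδv : Valued.v (ρ θ₀ - θ₀) = 1 := by rw [← Valuation.map_neg, neg_sub]; exact hθρ
  have hδ : ρ θ₀ - θ₀ ≠ 0 := fun h0 => by rw [h0, map_zero] at hδv; exact zero_ne_one hδv
  have hVρ : Valued.v (V - ρ θ₀) ≤ 1 := (Valuation.map_sub _ _ _).trans (max_le hV1 (by rw [hvρ]; exact hθ1))
  have hVθ : Valued.v (V - θ₀) ≤ 1 := (Valuation.map_sub _ _ _).trans (max_le hV1 hθ1)
  set x : K := a * (V - ρ θ₀) with hx
  set q : K := (x - ρ x) / (ρ θ₀ - θ₀) with hqdef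
  have hq1e : q + 1 = ((a - 1) * (V - ρ θ₀) - ρ (a - 1) * (V - θ₀)) / (ρ θ₀ - θ₀) := by
    rw [hqdef, hx, map_mul, map_sub, hρρ, hρV, map_sub, map_one, div_add_one hδ]
    congr 1
    ring
  have hq1 : Valued.v (q + 1) ≤ Valued.v (a - 1) := by
    rw [hq1e, map_div₀, hδv, div_one]
    refine (Valuation.map_sub _ _ _).trans (max_le ?_ ?_)
    · rw [Valuation.map_mul]
      calc Valued.v (a - 1) * Valued.v (V - ρ θ₀) ≤ Valued.v (a - 1) * 1 := by gcongr
        _ = _ := mul_one _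
    · rw [Valuation.map_mul, hvρ]
      calc Valued.v (a - 1) * Valued.v (V - θ₀) ≤ Valued.v (a - 1) * 1 := by gcongr
        _ = _ := mul_one _
  have hqv : Valued.v q = 1 := by
    have e : q = (q + 1) + (-1) := by ring
    have hlt : Valued.v (q + 1) < Valued.v (-1 : K) := by rw [Valuation.map_neg, Valuation.map_one]; exact lt_of_le_of_lt hq1 ha
    rw [e, Valuation.map_add_eq_of_lt_right _ hlt, Valuation.map_neg, Valuation.map_one]
  have hq0 : q ≠ 0 := fun h0 => by rw [h0, map_zero] at hqv; exact zero_ne_one hqv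
  refine ⟨hq1, hqv, ?_⟩
  have e : -(x - q * ρ θ₀) / q - V = -((a + q) * (V - ρ θ₀)) / q := by
    rw [hx]; field_simp; ring
  rw [e, map_div₀, Valuation.map_neg, Valuation.map_mul, hqv, div_one]
  have haq : Valued.v (a + q) ≤ Valued.v (a - 1) := by
    have e2 : a + q = (a - 1) + (q + 1) := by ring
    rw [e2]; exact (Valuation.map_add _ _ _).trans (max_le le_rfl hq1)
  calc Valued.v (a + q) * Valued.v (V - ρ θ₀) ≤ Valued.v (a - 1) * 1 := by gcongr
    _ = _ := mul_one _

/-- **DIGITS ARE RECOVERED FROM `ŵ(V)∕f`**: for `ρ`-fixed `V₁, V₂` with `|V₂| ≤ 1` and `ρ`-fixed units `f₁, f₂`, `|ŵ(V₁)∕f₁ − ŵ(V₂)∕f₂| ≤ r` implies `|V₁ − V₂| ≤ r`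
(the `ρ`-trace reads `1∕f₁ − 1∕f₂`, then `ŵ(V₁) − ŵ(V₂) = (V₁ − V₂)∕(θ₀ − ρθ₀)`). [cite: Serre1979, Ch. V §2 Prop. 3] -/
theorem v_sub_le_of_hatw_div (hρρ : ∀ x, ρ (ρ x) = x) (hvρ : ∀ x, Valued.v (ρ x) = Valued.v x) (hθρ : Valued.v (θ₀ - ρ θ₀) = 1) (hθ1 : Valued.v θ₀ ≤ 1)
    {V₁ V₂ f₁ f₂ : K} (hρV₁ : ρ V₁ = V₁) (hρV₂ : ρ V₂ = V₂) (hV₂ : Valued.v V₂ ≤ 1)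
    (hρf₁ : ρ f₁ = f₁) (hf₁ : Valued.v f₁ = 1) (hρf₂ : ρ f₂ = f₂) (hf₂ : Valued.v f₂ = 1) {r : ℤᵐ⁰}
    (h : Valued.v ((V₁ - ρ θ₀) / (θ₀ - ρ θ₀) / f₁ - (V₂ - ρ θ₀) / (θ₀ - ρ θ₀) / f₂) ≤ r) : Valued.v (V₁ - V₂) ≤ r := by
  have hθ₀ : ρ θ₀ ≠ θ₀ := fun h0 => by rw [h0, sub_self, map_zero] at hθρ; exact zero_ne_one hθρ
  have hδ' : θ₀ - ρ θ₀ ≠ 0 := sub_ne_zero.2 (Ne.symm hθ₀)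
  have hf₁0 : f₁ ≠ 0 := fun h0 => by rw [h0, map_zero] at hf₁; exact zero_ne_one hf₁
  have hf₂0 : f₂ ≠ 0 := fun h0 => by rw [h0, map_zero] at hf₂; exact zero_ne_one hf₂
  have e1 : ρ ((V₁ - ρ θ₀) / (θ₀ - ρ θ₀)) = 1 - (V₁ - ρ θ₀) / (θ₀ - ρ θ₀) := by
    linear_combination hatw_add_map_hatw (θ₀ := θ₀) hρρ hθ₀ hρV₁
  have e2 : ρ ((V₂ - ρ θ₀) / (θ₀ - ρ θ₀)) = 1 - (V₂ - ρ θ₀) / (θ₀ - ρ θ₀) := by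
    linear_combination hatw_add_map_hatw (θ₀ := θ₀) hρρ hθ₀ hρV₂
  set w₁ : K := (V₁ - ρ θ₀) / (θ₀ - ρ θ₀) with hw₁
  set w₂ : K := (V₂ - ρ θ₀) / (θ₀ - ρ θ₀) with hw₂
  -- the trace of the difference is `1/f₁ − 1/f₂`
  have htr : (w₁ / f₁ - w₂ / f₂) + ρ (w₁ / f₁ - w₂ / f₂) = 1 / f₁ - 1 / f₂ := by
    rw [map_sub, map_div₀ ρ w₁ f₁, map_div₀ ρ w₂ f₂, hρf₁, hρf₂, e1, e2]
    field_simp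
    ring
  have hinv : Valued.v (1 / f₁ - 1 / f₂) ≤ r := by
    rw [← htr]
    exact (Valuation.map_add _ _ _).trans (max_le h (by rw [hvρ]; exact h))
  have hw₂v : Valued.v w₂ ≤ 1 := by
    rw [hw₂, map_div₀, hθρ, div_one]
    exact (Valuation.map_sub _ _ _).trans (max_le hV₂ (by rw [hvρ]; exact hθ1))
  have e : w₁ - w₂ = f₁ * (w₁ / f₁ - w₂ / f₂) - w₂ * f₁ * (1 / f₁ - 1 / f₂) := by field_simp; ring
  have hww : Valued.v (w₁ - w₂) ≤ r := by
    rw [e]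
    refine (Valuation.map_sub _ _ _).trans (max_le ?_ ?_)
    · rw [Valuation.map_mul, hf₁, one_mul]; exact h
    · rw [Valuation.map_mul, Valuation.map_mul, hf₁, mul_one]
      calc Valued.v w₂ * Valued.v (1 / f₁ - 1 / f₂) ≤ 1 * r := by gcongr
        _ = r := one_mul r
  have e2' : V₁ - V₂ = (w₁ - w₂) * (θ₀ - ρ θ₀) := by rw [hw₁, hw₂]; field_simp; ring
  rw [e2', Valuation.map_mul, hθρ, mul_one]
  exact hww

/-! ## §2 HEAD — the `M∕K♮`-norm class of `ŵ(V)∕c` is balanced on every tail-digit orbit -/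

/-- **HEAD — «THE LITERAL HALVES EVERY TAIL-DIGIT ORBIT».**  One-field RamK letters: `ρ`, `Θ` commuting isometric involutions of `K` (= `M`), the ramified datum
`IsRamifiedQuadraticDatum Θ ϖE d t` (complete, finite residue field, `|2| < 1`), `hFN` (doubly fixed units are `Θ`-norms), a `Θ`-fixed integer `θ₀` with `|θ₀ − ρθ₀| = 1`, a
`Θ`-fixed unit `c`; `1 ≤ g ≤ d − 1`; a centre `V₀` and a finite `F` which is a COMPLETE IRREDUNDANT system of the doubly fixed integers `V` with `|V − V₀| ≤ |ϖE|^{2(d−g)}`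
modulo `|·| ≤ |ϖE|^{2d}` (the digits of one tail-digit orbit).  THEN `Σ_{V ∈ F} ω_Θ(ŵ(V)∕c) = 0`, `ŵ(V) = (V − ρθ₀)∕(θ₀ − ρθ₀)`: the transport `V ↦ digit(V′)` along the
`Θ`-fixed non-norm `c₁ ≡ 1 (ϖE^{2(d−1)})` (★ `exists_fixed_unit_not_norm_v_sub_one_le`; `c₁ŵ(V) = f″ŵ(V′)`, `f″ ∈ 𝒪_Fˣ ⊆ N`) permutes `F` and reverses the sign.
[cite: Serre1979, Ch. V §3 Prop. 5, Cor. 3 pp. 85–87] [cite: Serre1979, Ch. V §2 Prop. 3] [cite: Flicker1998UnitaryFL, Prop. 7 p. 84] [cite: Kottwitz1986BaseChangeUnits, §1 pp. 240–241] -/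
theorem sum_normSign_hatw_div_eq_zero [CompleteSpace K] [Finite 𝓀[K]] {ϖE : K} {d t : ℕ} (hD : IsRamifiedQuadraticDatum Θ ϖE d t) (h2v : Valued.v (2 : K) < 1)
    (hρρ : ∀ x, ρ (ρ x) = x) (hvρ : ∀ x, Valued.v (ρ x) = Valued.v x) (hΘρ : ∀ x, Θ (ρ x) = ρ (Θ x))
    (hFN : ∀ f : K, ρ f = f → Θ f = f → Valued.v f = 1 → ∃ z : K, z * Θ z = f)
    (hΘθ₀ : Θ θ₀ = θ₀) (hθ1 : Valued.v θ₀ ≤ 1) (hθρ : Valued.v (θ₀ - ρ θ₀) = 1)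
    {c : K} (hΘc : Θ c = c) (hc1 : Valued.v c = 1) {g : ℕ} (hg1 : 1 ≤ g) (hgd : g + 1 ≤ d)
    {V₀ : K} (F : Finset K) (hF1 : ∀ V ∈ F, ρ V = V ∧ Θ V = V ∧ Valued.v V ≤ 1 ∧ Valued.v (V - V₀) ≤ Valued.v ϖE ^ (2 * (d - g)))
    (hF2 : ∀ V : K, ρ V = V → Θ V = V → Valued.v V ≤ 1 → Valued.v (V - V₀) ≤ Valued.v ϖE ^ (2 * (d - g)) →
      ∃ V₁ ∈ F, Valued.v (V - V₁) ≤ Valued.v ϖE ^ (2 * d))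
    (hF3 : ∀ V ∈ F, ∀ V' ∈ F, Valued.v (V - V') ≤ Valued.v ϖE ^ (2 * d) → V = V') :
    ∑ V ∈ F, normSign Θ ((V - ρ θ₀) / (θ₀ - ρ θ₀) / c) = 0 := by
  classical
  obtain ⟨hΘΘ, hvΘ, hϖ, hfix, hdd, hd1, ht⟩ := hD
  have hvϖ0 : Valued.v ϖE ≠ 0 := by rw [hϖ]; exact exp_ne_zero
  have hϖ1 : Valued.v ϖE ≤ 1 := by rw [hϖ, ← exp_zero, exp_le_exp]; norm_num
  have hϖlt : Valued.v ϖE < 1 := by rw [hϖ, ← exp_zero, exp_lt_exp]; norm_num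
  have hθ₀ : ρ θ₀ ≠ θ₀ := fun h0 => by rw [h0, sub_self, map_zero] at hθρ; exact zero_ne_one hθρ
  have hδ' : θ₀ - ρ θ₀ ≠ 0 := sub_ne_zero.2 (Ne.symm hθ₀)
  have hc0 : c ≠ 0 := fun h0 => by rw [h0, map_zero] at hc1; exact zero_ne_one hc1
  -- the non-norm `c₁ ∈ U_{K♮}(2d−2)` and its size
  obtain ⟨c₁, hΘc₁, hc₁1, hc₁d, hc₁n⟩ := exists_fixed_unit_not_norm_v_sub_one_le ⟨hΘΘ, hvΘ, hϖ, hfix, hdd, hd1, ht⟩ h2v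
  have hc₁0 : c₁ ≠ 0 := fun h0 => by rw [h0, map_zero] at hc₁1; exact zero_ne_one hc₁1
  have hc₁dg : Valued.v (c₁ - 1) ≤ Valued.v ϖE ^ (2 * (d - g)) := by
    refine hc₁d.trans ?_
    rw [v_varpi_pow hϖ, exp_le_exp]; push_cast; omega
  have hc₁lt : Valued.v (c₁ - 1) < 1 := by
    refine lt_of_le_of_lt hc₁d ?_
    rw [← exp_zero, exp_lt_exp]; omega
  -- letters of `ŵ`
  have hŵunit : ∀ V : K, ρ V = V → Valued.v V ≤ 1 → Valued.v ((V - ρ θ₀) / (θ₀ - ρ θ₀)) = 1 := by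
    intro V hρV hV1
    -- `|V − ρθ₀| = 1`: `Tr_ρ ŵ = 1` forces `|ŵ| ≥ 1`, and `|ŵ| ≤ 1`
    have hle : Valued.v ((V - ρ θ₀) / (θ₀ - ρ θ₀)) ≤ 1 := by
      rw [map_div₀, hθρ, div_one]; exact (Valuation.map_sub _ _ _).trans (max_le hV1 (by rw [hvρ]; exact hθ1))
    have htr := hatw_add_map_hatw (θ₀ := θ₀) hρρ hθ₀ hρV
    by_contra hne
    have hlt : Valued.v ((V - ρ θ₀) / (θ₀ - ρ θ₀)) < 1 := lt_of_le_of_ne hle hne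
    have h1 : Valued.v ((V - ρ θ₀) / (θ₀ - ρ θ₀) + ρ ((V - ρ θ₀) / (θ₀ - ρ θ₀))) < 1 :=
      lt_of_le_of_lt (Valuation.map_add _ _ _) (max_lt hlt (by rw [hvρ]; exact hlt))
    rw [htr, Valuation.map_one] at h1
    exact lt_irrefl _ h1
  have hΘŵ : ∀ V : K, Θ V = V → Θ ((V - ρ θ₀) / (θ₀ - ρ θ₀)) = (V - ρ θ₀) / (θ₀ - ρ θ₀) := by
    intro V hΘV; rw [map_div₀, map_sub, map_sub, hΘV, hΘρ, hΘθ₀]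
  -- the transport `V ↦ V′` and its representative `φ V ∈ F`
  have htransport : ∀ V ∈ F, ∃ f'' V' : K, ρ f'' = f'' ∧ Θ f'' = f'' ∧ Valued.v f'' = 1 ∧ ρ V' = V' ∧ Θ V' = V' ∧ Valued.v V' ≤ 1 ∧
      Valued.v (V' - V₀) ≤ Valued.v ϖE ^ (2 * (d - g)) ∧ c₁ * ((V - ρ θ₀) / (θ₀ - ρ θ₀)) = f'' * ((V' - ρ θ₀) / (θ₀ - ρ θ₀)) := by
    intro V hV
    obtain ⟨hρV, hΘV, hV1, hVV₀⟩ := hF1 V hV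
    have hΘx : Θ (c₁ * (V - ρ θ₀)) = c₁ * (V - ρ θ₀) := by rw [map_mul, hΘc₁, map_sub, hΘV, hΘρ, hΘθ₀]
    obtain ⟨hρq, hΘq⟩ := map_coordq hρρ hΘρ hΘθ₀ hθ₀ hΘx
    obtain ⟨hρp, hΘp⟩ := map_coordp hρρ hΘρ hΘθ₀ hθ₀ hΘx
    obtain ⟨hq1, hqv, hV'⟩ := v_transport_le (θ₀ := θ₀) hρρ hvρ hθρ hθ1 hc₁lt hρV hV1
    set x : K := c₁ * (V - ρ θ₀) with hx
    set q : K := (x - ρ x) / (ρ θ₀ - θ₀) with hq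
    set p : K := x - q * ρ θ₀ with hp
    have hq0 : q ≠ 0 := fun h0 => by rw [h0, map_zero] at hqv; exact zero_ne_one hqv
    refine ⟨-q, -p / q, by rw [map_neg, hρq], by rw [map_neg, hΘq], by rw [Valuation.map_neg, hqv],
      by rw [map_div₀, map_neg, hρp, hρq], by rw [map_div₀, map_neg, hΘp, hΘq], ?_, ?_, ?_⟩
    · -- `|V'| ≤ 1`
      have e : -p / q = (-p / q - V) + V := by ring
      rw [e]
      exact (Valuation.map_add _ _ _).trans (max_le (hV'.trans hc₁lt.le) hV1)
    · have e : -p / q - V₀ = (-p / q - V) + (V - V₀) := by ring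
      rw [e]
      exact (Valuation.map_add _ _ _).trans (max_le (hV'.trans hc₁dg) hVV₀)
    · exact mul_hatw_eq (θ₀ := θ₀) hθ₀ hq0 (by rw [hp]; ring)
  choose! f'' V' hρf'' hΘf'' hf''1 hρV' hΘV' hV'1 hV'V₀ htrans using htransport
  have hrep : ∀ V ∈ F, ∃ W ∈ F, Valued.v (V' V - W) ≤ Valued.v ϖE ^ (2 * d) := fun V hV =>
    hF2 (V' V) (hρV' V hV) (hΘV' V hV) (hV'1 V hV) (hV'V₀ V hV)
  choose! φ hφF hφ using hrep
  -- the sign flips along the transport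
  have hflip : ∀ V ∈ F, normSign Θ ((φ V - ρ θ₀) / (θ₀ - ρ θ₀) / c) = -normSign Θ ((V - ρ θ₀) / (θ₀ - ρ θ₀) / c) := by
    intro V hV
    obtain ⟨hρV, hΘV, hV1, -⟩ := hF1 V hV
    obtain ⟨hρφ, hΘφ, hφ1, -⟩ := hF1 (φ V) (hφF V hV)
    have hf0 : f'' V ≠ 0 := fun h0 => by have := hf''1 V hV; rw [h0, map_zero] at this; exact zero_ne_one this
    -- `ŵ(V')/c` is a `Θ`-fixed unit near `ŵ(φ V)/c`
    have hΘg : Θ ((V' V - ρ θ₀) / (θ₀ - ρ θ₀) / c) = (V' V - ρ θ₀) / (θ₀ - ρ θ₀) / c := by rw [map_div₀, hΘŵ _ (hΘV' V hV), hΘc]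
    have hΘg' : Θ ((φ V - ρ θ₀) / (θ₀ - ρ θ₀) / c) = (φ V - ρ θ₀) / (θ₀ - ρ θ₀) / c := by rw [map_div₀, hΘŵ _ hΘφ, hΘc]
    have hgv : Valued.v ((V' V - ρ θ₀) / (θ₀ - ρ θ₀) / c) = 1 := by rw [map_div₀, hŵunit _ (hρV' V hV) (hV'1 V hV), hc1, div_one]
    have hnear : Valued.v ((V' V - ρ θ₀) / (θ₀ - ρ θ₀) / c - (φ V - ρ θ₀) / (θ₀ - ρ θ₀) / c) ≤ Valued.v ϖE ^ (2 * d) := by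
      have e : (V' V - ρ θ₀) / (θ₀ - ρ θ₀) / c - (φ V - ρ θ₀) / (θ₀ - ρ θ₀) / c = (V' V - φ V) / (θ₀ - ρ θ₀) / c := by field_simp; ring
      rw [e, map_div₀, map_div₀, hθρ, hc1, div_one, div_one]
      exact hφ V hV
    rw [normSign_eq_of_near ⟨hΘΘ, hvΘ, hϖ, hfix, hdd, hd1, ht⟩ hΘg hΘg' hgv (n := 2 * d) (by omega) hnear]
    -- `ŵ(V')/c = c₁ · (1/f'') · (ŵ(V)/c)`
    have hident : (V' V - ρ θ₀) / (θ₀ - ρ θ₀) / c = c₁ * ((f'' V)⁻¹ * ((V - ρ θ₀) / (θ₀ - ρ θ₀) / c)) := by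
      have h := htrans V hV
      field_simp
      field_simp at h
      linear_combination -h
    have hΘinner : Θ ((f'' V)⁻¹ * ((V - ρ θ₀) / (θ₀ - ρ θ₀) / c)) = (f'' V)⁻¹ * ((V - ρ θ₀) / (θ₀ - ρ θ₀) / c) := by
      rw [map_mul, map_inv₀, hΘf'' V hV, map_div₀, hΘŵ _ hΘV, hΘc]
    have hinner0 : (f'' V)⁻¹ * ((V - ρ θ₀) / (θ₀ - ρ θ₀) / c) ≠ 0 := by
      refine mul_ne_zero (inv_ne_zero hf0) (div_ne_zero (fun h0 => ?_) hc0)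
      have := hŵunit V hρV hV1; rw [h0, map_zero] at this; exact zero_ne_one this
    have hw0 : (V - ρ θ₀) / (θ₀ - ρ θ₀) / c ≠ 0 := by
      refine div_ne_zero (fun h0 => ?_) hc0
      have := hŵunit V hρV hV1; rw [h0, map_zero] at this; exact zero_ne_one this
    rw [hident, normSign_mul_of_fixed ⟨hΘΘ, hvΘ, hϖ, hfix, hdd, hd1, ht⟩ hΘc₁ hΘinner hc₁0 hinner0, normSign_of_not_isNorm Θ hc₁n,
      normSign_mul_of_fixed ⟨hΘΘ, hvΘ, hϖ, hfix, hdd, hd1, ht⟩ (by rw [map_inv₀, hΘf'' V hV]) (by rw [map_div₀, hΘŵ _ hΘV, hΘc]) (inv_ne_zero hf0) hw0,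
      normSign_of_isNorm Θ (hFN _ (by rw [map_inv₀, hρf'' V hV]) (by rw [map_inv₀, hΘf'' V hV]) (by rw [map_inv₀, hf''1 V hV, inv_one]))]
    ring
  -- `φ` is injective on `F` (digits are recovered from `ŵ(V)/f''`), hence a permutation
  have hinj : ∀ V₁ ∈ F, ∀ V₂ ∈ F, φ V₁ = φ V₂ → V₁ = V₂ := by
    intro V₁ hV₁ V₂ hV₂ heq
    obtain ⟨hρ1, -, h11, -⟩ := hF1 V₁ hV₁
    obtain ⟨hρ2, -, h21, -⟩ := hF1 V₂ hV₂
    apply hF3 V₁ hV₁ V₂ hV₂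
    -- `|V'₁ − V'₂| ≤ ϖ^{2d}`
    have h12 : Valued.v (V' V₁ - V' V₂) ≤ Valued.v ϖE ^ (2 * d) := by
      have e : V' V₁ - V' V₂ = (V' V₁ - φ V₁) - (V' V₂ - φ V₂) := by rw [heq]; ring
      rw [e]; exact (Valuation.map_sub _ _ _).trans (max_le (hφ V₁ hV₁) (hφ V₂ hV₂))
    -- hence `|c₁|·|ŵ(V₁)/f''₁ − ŵ(V₂)/f''₂| ≤ ϖ^{2d}`
    have hf10 : f'' V₁ ≠ 0 := fun h0 => by have := hf''1 V₁ hV₁; rw [h0, map_zero] at this; exact zero_ne_one this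
    have hf20 : f'' V₂ ≠ 0 := fun h0 => by have := hf''1 V₂ hV₂; rw [h0, map_zero] at this; exact zero_ne_one this
    have hquot : Valued.v ((V₁ - ρ θ₀) / (θ₀ - ρ θ₀) / f'' V₁ - (V₂ - ρ θ₀) / (θ₀ - ρ θ₀) / f'' V₂) ≤ Valued.v ϖE ^ (2 * d) := by
      have e : (V₁ - ρ θ₀) / (θ₀ - ρ θ₀) / f'' V₁ - (V₂ - ρ θ₀) / (θ₀ - ρ θ₀) / f'' V₂ =
          c₁⁻¹ * (((V' V₁ - ρ θ₀) / (θ₀ - ρ θ₀) - (V' V₂ - ρ θ₀) / (θ₀ - ρ θ₀))) := by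
        have h1 := htrans V₁ hV₁; have h2 := htrans V₂ hV₂
        field_simp
        field_simp at h1 h2
        linear_combination (f'' V₂) * h1 - (f'' V₁) * h2
      rw [e, Valuation.map_mul, map_inv₀, hc₁1, inv_one, one_mul]
      have e2 : (V' V₁ - ρ θ₀) / (θ₀ - ρ θ₀) - (V' V₂ - ρ θ₀) / (θ₀ - ρ θ₀) = (V' V₁ - V' V₂) / (θ₀ - ρ θ₀) := by field_simp; ring
      rw [e2, map_div₀, hθρ, div_one]
      exact h12
    exact v_sub_le_of_hatw_div (θ₀ := θ₀) hρρ hvρ hθρ hθ1 hρ1 hρ2 h21 (hρf'' V₁ hV₁) (hf''1 V₁ hV₁) (hρf'' V₂ hV₂) (hf''1 V₂ hV₂) hquot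
  have hsum : ∑ V ∈ F, normSign Θ ((φ V - ρ θ₀) / (θ₀ - ρ θ₀) / c) = ∑ V ∈ F, normSign Θ ((V - ρ θ₀) / (θ₀ - ρ θ₀) / c) :=
    sum_bij (fun V _ => φ V) (fun V hV => hφF V hV) (fun V₁ hV₁ V₂ hV₂ h => hinj V₁ hV₁ V₂ hV₂ h)
      (fun W hW => by
        have himg : F.image φ = F := eq_of_subset_of_card_le (image_subset_iff.2 fun V hV => hφF V hV)
          (by rw [card_image_of_injOn (fun V₁ hV₁ V₂ hV₂ h => hinj V₁ hV₁ V₂ hV₂ h)])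
        have hW' : W ∈ F.image φ := by rw [himg]; exact hW
        obtain ⟨V, hV, hVW⟩ := mem_image.1 hW'
        exact ⟨V, hV, hVW⟩)
      (fun _ _ => rfl)
  have hneg : ∑ V ∈ F, normSign Θ ((φ V - ρ θ₀) / (θ₀ - ρ θ₀) / c) = -∑ V ∈ F, normSign Θ ((V - ρ θ₀) / (θ₀ - ρ θ₀) / c) := by
    rw [← sum_neg_distrib]; exact sum_congr rfl hflip
  have h2 : (2 : ℤ) * ∑ V ∈ F, normSign Θ ((V - ρ θ₀) / (θ₀ - ρ θ₀) / c) = 0 := by linarith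
  simpa using h2

/-- **THE HALVING LETTER AS A COUNT**: under `sum_normSign_hatw_div_eq_zero`'s letters, `2·#{V ∈ F ∣ ω_Θ(ŵ(V)∕c) = 1} = #F` — the `hhalf` shape of ★-cand
`F0P3cDyRamDiagonalCellLabelDigits.card_filter_lit_plus_eq_card_filter_lit_not` (one tail-digit orbit at a time).
[cite: Serre1979, Ch. V §3 Cor. 3 pp. 85–87] [cite: Rogawski1990, §4.9 Prop. 4.9.1 (b) p. 55] -/
theorem two_mul_card_filter_lit_eq_card [CompleteSpace K] [Finite 𝓀[K]] {ϖE : K} {d t : ℕ} (hD : IsRamifiedQuadraticDatum Θ ϖE d t) (h2v : Valued.v (2 : K) < 1)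
    (hρρ : ∀ x, ρ (ρ x) = x) (hvρ : ∀ x, Valued.v (ρ x) = Valued.v x) (hΘρ : ∀ x, Θ (ρ x) = ρ (Θ x))
    (hFN : ∀ f : K, ρ f = f → Θ f = f → Valued.v f = 1 → ∃ z : K, z * Θ z = f)
    (hΘθ₀ : Θ θ₀ = θ₀) (hθ1 : Valued.v θ₀ ≤ 1) (hθρ : Valued.v (θ₀ - ρ θ₀) = 1)
    {c : K} (hΘc : Θ c = c) (hc1 : Valued.v c = 1) {g : ℕ} (hg1 : 1 ≤ g) (hgd : g + 1 ≤ d)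
    {V₀ : K} (F : Finset K) (hF1 : ∀ V ∈ F, ρ V = V ∧ Θ V = V ∧ Valued.v V ≤ 1 ∧ Valued.v (V - V₀) ≤ Valued.v ϖE ^ (2 * (d - g)))
    (hF2 : ∀ V : K, ρ V = V → Θ V = V → Valued.v V ≤ 1 → Valued.v (V - V₀) ≤ Valued.v ϖE ^ (2 * (d - g)) →
      ∃ V₁ ∈ F, Valued.v (V - V₁) ≤ Valued.v ϖE ^ (2 * d))
    (hF3 : ∀ V ∈ F, ∀ V' ∈ F, Valued.v (V - V') ≤ Valued.v ϖE ^ (2 * d) → V = V') :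
    2 * (F.filter fun V => normSign Θ ((V - ρ θ₀) / (θ₀ - ρ θ₀) / c) = 1).card = F.card := by
  classical
  have hsum := sum_normSign_hatw_div_eq_zero hD h2v hρρ hvρ hΘρ hFN hΘθ₀ hθ1 hθρ hΘc hc1 hg1 hgd F hF1 hF2 hF3
  rw [sum_normSign_eq_card_sub_card Θ F (fun V => (V - ρ θ₀) / (θ₀ - ρ θ₀) / c)] at hsum
  have hminus : (F.filter fun V => normSign Θ ((V - ρ θ₀) / (θ₀ - ρ θ₀) / c) = -1) = F.filter fun V => ¬ normSign Θ ((V - ρ θ₀) / (θ₀ - ρ θ₀) / c) = 1 := by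
    refine filter_congr fun V _ => ?_
    rcases normSign_eq_one_or Θ ((V - ρ θ₀) / (θ₀ - ρ θ₀) / c) with h | h
    · rw [h]; norm_num
    · rw [h]; norm_num
  rw [hminus] at hsum
  have htot := card_filter_add_card_filter_not (s := F) (fun V => normSign Θ ((V - ρ θ₀) / (θ₀ - ρ θ₀) / c) = 1)
  omega

end Summit.HodgeConjecture.HodgeConjecture.Cruxes.H413.F0P3cDyRamDiagonalCellLiteralDigits

end
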